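import Summits.AnomalousDissipation.AnomalousDissipation.Theorems.SawtoothPulseCascadeK1LocalisedCascadeHalfStepVT
import Summits.AnomalousDissipation.AnomalousDissipation.Theorems.SawtoothPulseCascadeK1LocalisedCascadeTrapezoidFejer

/-!
# K1loc, line `Spectral` / thin start — helper: THE V HALF-STEP ON A FIBRE BLOCK WITH EXPLICIT TRAPEZOIDS (ledger-ready form)

Helper file of the prover lane on the crux `K1LocalisedCascade` (stmt-AnomalousDissipation-19491), route
`SawtoothPulseCascade` (S-D fibre ledger; memo v10 §11).  Instantiation of `…HalfStepVT.sum_window_sq_norm_vstep_twist_le`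
for a window `W ⊆ {|k₀| < K} × {Λ ≤ |k₁| ≤ Λ'}` (a strip window on a block of fibres), with
* the input cut-off `χ` = the trapezoid with plateau `Q₁` and support `Q₂` in `k₀` (`‖k_χ‖₁ ≤ (Q₁+Q₂)/(Q₂−Q₁)`),
* the per-fibre symbols `ψ_n` = the MAXIMAL-RAMP trapezoids with plateau `p = K + Q₂` and support `|n|γ` (fat whenever the fibre
  allows it): `‖k_{ψ_n}‖₁ ≤ A := (p + Λγ)/(Λγ − p)`, tails `≤ τ/δ`, `τ := π/(Λγ − p)`, uniformly on the block,
and the pass-through term converted to a spectral class of the INPUT: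
**`sum_stripBlock_vstep_le`** —
`Σ_{k∈W}‖𝓕(b∘Φ_V)(k)‖² ≤ (((Q₁+Q₂)/(Q₂−Q₁))·(ε₀ + A√(2N_j·4d₀)) + √(Σ' k, [Λ ≤ |k₁| ≤ Λ' ∧ Q₁ < |k₀|]‖𝓕b(k)‖²))²`
under `8τ ≤ A d₀`, `Mδ_j < πN_j d₀`, `ε₀ ≥ A·π Λ'γ e^{−M²/2}/N_j`.  §1 is the spectral form of the pass-through term.
No definitions; no statement about the crux. [cite: Grafakos2014, Prop. 3.1.2 (5), Prop. 3.2.7 (3), §3.1.3]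
[cite: ElgindiLissMattingly2025, §1 (slope ±1 branches)] [problem: turb]
-/

-- `Summit.<Summit>.<Problem>`: single-conjunct summit, the duplicate namespace segment is deliberate.
set_option linter.dupNamespace false

noncomputable section

namespace Summit.AnomalousDissipation.AnomalousDissipation.Theorems.SawtoothPulseCascade.K1Window

open MeasureTheory Set Filter Topology UnitAddTorus Function Complex Metric
open scoped Real ENNReal
open Literature.Analysis Literature.Analysis.FunctionSpaces Literature.Analysis.FunctionSpaces.Torus Literature.Analysis.FluidPDE
open Literature.Analysis.FluidPDE.ShearStage
open Literature.Analysis.FluidPDE.SawtoothCascade Literature.Analysis.FluidPDE.SawtoothCascade.CascadeParams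
open Summit.AnomalousDissipation.AnomalousDissipation.Theorems.SawtoothPulseCascade.K1Start
open Summit.AnomalousDissipation.AnomalousDissipation.Theorems.SawtoothPulseCascade.K1Flat

/-! ## §1 The pass-through term as a spectral class of the input -/

/-- Torus Fourier coefficients of a difference of continuous functions. [cite: Grafakos2014, Prop. 3.1.2 (5)] -/
theorem mFourierCoeff_sub_of_continuous {b T : UnitAddTorus (Fin 2) → ℂ} (hb : Continuous b) (hT : Continuous T)
    (k : Fin 2 → ℤ) : mFourierCoeff (fun x => b x - T x) k = mFourierCoeff b k - mFourierCoeff T k := by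
  have h1 := Torus.mFourierCoeff_add (F := ℂ) ((hb.sub hT).integrable_unitAddTorus) (hT.integrable_unitAddTorus) k
  rw [sub_add_cancel] at h1
  rw [show (fun x => b x - T x) = b - T from rfl]
  exact eq_sub_of_add_eq h1.symm

/-- **The pass-through term is the input energy under `(1−χ(k₀))²` on the fibres of the window**: for a real symbol
`0 ≤ χ ≤ 1` with `χ = 1` on `|k₀| ≤ Q₁`, supported in `Sχ`, and a finite fibre set `F ⊆ {Λ ≤ |n| ≤ Λ'}`,
`Σ_{n∈F} ∫‖A¹_n(b − T_χ b)‖² ≤ Σ' k, [Λ ≤ |k₁| ≤ Λ' ∧ Q₁ < |k₀|]‖𝓕b(k)‖²`. [cite: Grafakos2014, Prop. 3.2.7 (3)] -/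
theorem sum_passThrough_le_tsum {b : UnitAddTorus (Fin 2) → ℂ} (hb : Continuous b) {χ : ℤ → ℂ} {Sχ : Finset ℤ}
    (hχS : ∀ l, l ∉ Sχ → χ l = 0) (hχr : ∀ l, ∃ r : ℝ, 0 ≤ r ∧ r ≤ 1 ∧ χ l = (r : ℂ)) {Q₁ : ℕ}
    (hχ1 : ∀ l : ℤ, |l| ≤ Q₁ → χ l = 1) (F : Finset ℤ) {Λ Λ' : ℕ} (hF : ∀ n ∈ F, (Λ : ℤ) ≤ |n| ∧ |n| ≤ Λ') :
    ∑ n ∈ F, ∫ x : UnitAddTorus (Fin 2), ‖∫ s : UnitAddCircle, (fourier (-n) s : ℂ) •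
        (b (x + Pi.single (1 : Fin 2) s) - ∑ l ∈ Sχ, χ l * ∫ s' : UnitAddCircle,
          (fourier (-l) s' : ℂ) • b (x + Pi.single (1 : Fin 2) s + Pi.single (0 : Fin 2) s'))‖ ^ 2 ≤
      ∑' k : Fin 2 → ℤ, (if (Λ : ℤ) ≤ |k 1| ∧ |k 1| ≤ Λ' ∧ (Q₁ : ℤ) < |k 0| then (1 : ℝ) else 0) *
        ‖mFourierCoeff b k‖ ^ 2 := by
  classical
  set T : UnitAddTorus (Fin 2) → ℂ := fun x => ∑ l ∈ Sχ, χ l *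
    ∫ s : UnitAddCircle, (fourier (-l) s : ℂ) • b (x + Pi.single (0 : Fin 2) s) with hT
  have hTc : Continuous T := continuous_finsetSum _ fun l _ => continuous_const.mul (continuous_twistedAxisAvg hb 0 l)
  set θ : UnitAddTorus (Fin 2) → ℂ := fun x => b x - T x with hθ
  have hθc : Continuous θ := hb.sub hTc
  have hcoef : ∀ k, mFourierCoeff θ k = (1 - χ (k 0)) * mFourierCoeff b k := fun k => by
    simp only [hθ]
    rw [mFourierCoeff_sub_of_continuous hb hTc, mFourierCoeff_axisCutoff hb 0 hχS k]; ring
  -- each slab integral is a spectral sum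
  have hslab : ∀ n, ∫ x : UnitAddTorus (Fin 2), ‖∫ s : UnitAddCircle, (fourier (-n) s : ℂ) •
      (b (x + Pi.single (1 : Fin 2) s) - ∑ l ∈ Sχ, χ l * ∫ s' : UnitAddCircle,
        (fourier (-l) s' : ℂ) • b (x + Pi.single (1 : Fin 2) s + Pi.single (0 : Fin 2) s'))‖ ^ 2 =
      ∑' k : Fin 2 → ℤ, (if k 1 = n then (1 : ℝ) else 0) * ‖mFourierCoeff θ k‖ ^ 2 :=
    fun n => ((hasSum_slab hθc 1 n).tsum_eq).symm
  simp_rw [hslab]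
  have hsum : ∀ n, Summable fun k : Fin 2 → ℤ => (if k 1 = n then (1 : ℝ) else 0) * ‖mFourierCoeff θ k‖ ^ 2 :=
    fun n => (hasSum_slab hθc 1 n).summable
  rw [← Summable.tsum_finsetSum (fun n _ => hsum n)]
  -- termwise comparison
  have hbsum : Summable fun k : Fin 2 → ℤ => ‖mFourierCoeff b k‖ ^ 2 := (hasSum_sq_mFourierCoeff_of_continuous hb).summable
  have hR : Summable fun k : Fin 2 → ℤ => (if (Λ : ℤ) ≤ |k 1| ∧ |k 1| ≤ Λ' ∧ (Q₁ : ℤ) < |k 0| then (1 : ℝ) else 0) *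
      ‖mFourierCoeff b k‖ ^ 2 := by
    refine Summable.of_nonneg_of_le (fun k => mul_nonneg (by split_ifs <;> norm_num) (sq_nonneg _)) (fun k => ?_) hbsum
    exact mul_le_of_le_one_left (sq_nonneg _) (by split_ifs <;> norm_num)
  have hpt : ∀ k : Fin 2 → ℤ, ∑ n ∈ F, (if k 1 = n then (1 : ℝ) else 0) * ‖mFourierCoeff θ k‖ ^ 2 ≤
      (if (Λ : ℤ) ≤ |k 1| ∧ |k 1| ≤ Λ' ∧ (Q₁ : ℤ) < |k 0| then (1 : ℝ) else 0) * ‖mFourierCoeff b k‖ ^ 2 := by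
    intro k
    rw [← Finset.sum_mul, Finset.sum_ite_eq]
    obtain ⟨r, hr0, hr1, hr⟩ := hχr (k 0)
    have hnorm : ‖mFourierCoeff θ k‖ ^ 2 = (1 - r) ^ 2 * ‖mFourierCoeff b k‖ ^ 2 := by
      rw [hcoef k, norm_mul, mul_pow, hr, show (1 : ℂ) - (r : ℂ) = ((1 - r : ℝ) : ℂ) by push_cast; ring,
        Complex.norm_real, Real.norm_eq_abs, sq_abs]
    by_cases hkF : k 1 ∈ F
    · rw [if_pos hkF, one_mul, hnorm]
      obtain ⟨h1, h2⟩ := hF _ hkF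
      by_cases hq : (Q₁ : ℤ) < |k 0|
      · rw [if_pos ⟨h1, h2, hq⟩, one_mul]
        exact mul_le_of_le_one_left (sq_nonneg _) (by nlinarith)
      · push Not at hq
        have : r = 1 := by
          have h := hχ1 _ hq
          rw [hr] at h
          exact_mod_cast h
        rw [this]
        simp only [sub_self, ne_eq, OfNat.ofNat_ne_zero, not_false_eq_true, zero_pow, zero_mul]
        exact mul_nonneg (by split_ifs <;> norm_num) (sq_nonneg _)
    · rw [if_neg hkF, zero_mul]
      exact mul_nonneg (by split_ifs <;> norm_num) (sq_nonneg _)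
  exact Summable.tsum_le_tsum hpt (summable_sum fun n _ => hsum n) hR

/-! ## §2 The strip-block V half-step with explicit trapezoids -/

/-- **THE V HALF-STEP ON A FIBRE BLOCK** (see the file header).  `W ⊆ {|k₀| < K} × {Λ ≤ |k₁| ≤ Λ'}` finite; `χ` the
`(Q₁, Q₂)` trapezoid in `k₀`; `ψ_n` the `(K+Q₂, |n|γ)` trapezoids; `A = (K+Q₂+Λγ)/(Λγ−K−Q₂)`, `τ = π/(Λγ−K−Q₂)`.
[cite: Grafakos2014, Prop. 3.1.2 (5), Prop. 3.2.7 (3), §3.1.3] -/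
theorem sum_stripBlock_vstep_le (P : CascadeParams) {G : ℕ} (hγ : P.γ = G) (hδ₀ : 0 < P.δ₀) (hd : 0 < P.d)
    (hN₀ : 1 ≤ P.N₀) (hρN : 1 ≤ P.ρN) (j : ℕ)
    {b : UnitAddTorus (Fin 2) → ℂ} (hb : Continuous b) (hbs : Summable fun k => ‖mFourierCoeff b k‖) (hb1 : ∀ x, ‖b x‖ ≤ 1)
    {K Q₁ Q₂ Λ Λ' : ℕ} (hQ : Q₁ < Q₂) (hΛ : K + Q₂ < Λ * G)
    (W : Finset (Fin 2 → ℤ)) (hW : ∀ k ∈ W, |k 0| < (K : ℤ) ∧ (Λ : ℤ) ≤ |k 1| ∧ |k 1| ≤ Λ')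
    {d₀ M ε₀ : ℝ} (hd₀ : 0 < d₀) (hM : 1 ≤ M) (hMδ : M * P.δ j < π / 2) (hMd : M * P.δ j < π * P.N j * d₀)
    (hAd : 8 * (π / (((Λ * G : ℕ) : ℝ) - (K + Q₂ : ℕ))) ≤ (((K + Q₂ : ℕ) : ℝ) + (Λ * G : ℕ)) / (((Λ * G : ℕ) : ℝ) - (K + Q₂ : ℕ)) * d₀)
    (hε0 : 0 ≤ ε₀)
    (hε : (((K + Q₂ : ℕ) : ℝ) + (Λ * G : ℕ)) / (((Λ * G : ℕ) : ℝ) - (K + Q₂ : ℕ)) *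
      (2 * π * ((Λ' * G : ℕ) : ℝ) * (Real.exp (-(M ^ 2 / 2)) / (2 * P.N j))) ≤ ε₀) :
    ∑ k ∈ W, ‖mFourierCoeff (b ∘ shearMap 1 0 (amp ⟨P.U j, P.U_periodic j, P.contDiff_U (P.δ_pos hδ₀ hd j)⟩ P.γ)) k‖ ^ 2 ≤
      ((((Q₁ : ℝ) + Q₂) / ((Q₂ : ℝ) - Q₁)) *
          (ε₀ + (((K + Q₂ : ℕ) : ℝ) + (Λ * G : ℕ)) / (((Λ * G : ℕ) : ℝ) - (K + Q₂ : ℕ)) *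
            Real.sqrt ((2 * P.N j : ℕ) * (4 * d₀))) +
        Real.sqrt (∑' k : Fin 2 → ℤ, (if (Λ : ℤ) ≤ |k 1| ∧ |k 1| ≤ Λ' ∧ (Q₁ : ℤ) < |k 0| then (1 : ℝ) else 0) *
          ‖mFourierCoeff b k‖ ^ 2)) ^ 2 := by
  classical
  -- the data of `…HalfStepVT`
  set p : ℕ := K + Q₂ with hp
  set χ : ℤ → ℂ := fun m => ((min 1 (max 0 (((Q₂ : ℝ) - |(m : ℝ)|) / ((Q₂ : ℝ) - Q₁))) : ℝ) : ℂ) with hχdef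
  have hχ : ∀ m : ℤ, χ m = ((min 1 (max 0 (((Q₂ : ℝ) - |(m : ℝ)|) / ((Q₂ : ℝ) - Q₁))) : ℝ) : ℂ) := fun m => rfl
  set ψ : ℤ → ℤ → ℂ := fun n m => if p < n.natAbs * G then
      ((min 1 (max 0 ((((n.natAbs * G : ℕ) : ℝ) - |(m : ℝ)|) / (((n.natAbs * G : ℕ) : ℝ) - p))) : ℝ) : ℂ) else 0 with hψdef
  set Sψ : ℤ → Finset ℤ := fun n => Finset.Icc (-((n.natAbs * G : ℕ) : ℤ)) (n.natAbs * G : ℕ) with hSψ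
  set A : ℝ := (((K + Q₂ : ℕ) : ℝ) + (Λ * G : ℕ)) / (((Λ * G : ℕ) : ℝ) - (K + Q₂ : ℕ)) with hA
  set τ : ℝ := π / (((Λ * G : ℕ) : ℝ) - (K + Q₂ : ℕ)) with hτ
  have hpΛ : (p : ℝ) < (Λ * G : ℕ) := by exact_mod_cast hΛ
  have hDpos : (0 : ℝ) < ((Λ * G : ℕ) : ℝ) - (K + Q₂ : ℕ) := by rw [← hp]; linarith
  have hA0 : 0 ≤ A := div_nonneg (by positivity) hDpos.le
  -- fibres of the window: `p < |n| G`, and the trapezoid facts on them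
  have hnat : ∀ k ∈ W, Λ ≤ (k 1).natAbs ∧ (k 1).natAbs ≤ Λ' := fun k hk => by
    obtain ⟨-, h2, h3⟩ := hW k hk
    rw [← Int.natCast_natAbs] at h2 h3
    exact ⟨by exact_mod_cast h2, by exact_mod_cast h3⟩
  have hfib : ∀ k ∈ W, p < (k 1).natAbs * G := fun k hk =>
    lt_of_lt_of_le hΛ (Nat.mul_le_mul_right _ (hnat k hk).1)
  have hψk : ∀ k ∈ W, ∀ m : ℤ, ψ (k 1) m =
      ((min 1 (max 0 (((((k 1).natAbs * G : ℕ) : ℝ) - |(m : ℝ)|) / ((((k 1).natAbs * G : ℕ) : ℝ) - p))) : ℝ) : ℂ) :=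
    fun k hk m => by simp only [hψdef, if_pos (hfib k hk)]
  have hnG : ∀ n : ℤ, ((n.natAbs * G : ℕ) : ℤ) = |n * G| := fun n => by
    rw [abs_mul, Nat.cast_mul, Int.natCast_natAbs, abs_of_nonneg (Int.natCast_nonneg G)]
  -- the hypotheses of the abstract half-step
  have hχS : ∀ l, l ∉ Finset.Icc (-(Q₂ : ℤ)) Q₂ → χ l = 0 := trapezoid_support hQ hχ
  have hχ1 : ∀ l, ‖χ l‖ ≤ 1 := fun l => (trapezoid_values hQ hχ l).2.2
  have hχL : ∀ l, χ l ≠ 0 → |l| < (Q₂ : ℤ) := fun l hl => by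
    by_contra h; push Not at h; exact hl ((trapezoid_values hQ hχ l).2.1 h)
  have hψS : ∀ n m, m ∉ Sψ n → ψ n m = 0 := by
    intro n m hm
    by_cases hn : p < n.natAbs * G
    · have := trapezoid_support hn (χ := ψ n) (fun m' => by simp only [hψdef, if_pos hn]) m hm
      exact this
    · simp only [hψdef, if_neg hn]
  have hψ0 : ∀ k ∈ W, ψ (k 1) (k 1 * G) = 0 ∧ ψ (k 1) (-(k 1 * G)) = 0 := by
    intro k hk
    have hv := fun m => trapezoid_values (hfib k hk) (hψk k hk) m
    refine ⟨(hv _).2.1 ?_, (hv _).2.1 ?_⟩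
    · rw [hnG]
    · rw [hnG, abs_neg]
  have hψ1 : ∀ k ∈ W, ∀ l : ℤ, |l| < (Q₂ : ℤ) → ψ (k 1) (k 0 - l) = 1 := by
    intro k hk l hl
    refine (trapezoid_values (hfib k hk) (hψk k hk) _).1 ?_
    have h0 := (hW k hk).1
    have : |k 0 - l| ≤ |k 0| + |l| := abs_sub _ _
    simp only [hp, Nat.cast_add]
    linarith
  have hA' : ∀ k ∈ W, (∫ s : UnitAddCircle, ‖∑ m ∈ Sψ (k 1), ψ (k 1) m * fourier (-m) s‖) ≤ A := by
    intro k hk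
    refine (integral_norm_trapezoidKernel_le_ratio (hfib k hk) (hψk k hk)).trans ?_
    -- `(p + x)/(x − p)` is decreasing in `x ≥ Λγ > p`
    have hx : ((Λ * G : ℕ) : ℝ) ≤ (((k 1).natAbs * G : ℕ) : ℝ) := by
      exact_mod_cast Nat.mul_le_mul_right _ (hnat k hk).1
    have hp0 : (0 : ℝ) ≤ p := Nat.cast_nonneg _
    rw [hA, div_le_div_iff₀ (by linarith) hDpos]
    nlinarith [mul_le_mul_of_nonneg_left hx hp0]
  have hτ' : ∀ k ∈ W, ∀ δ : ℝ, 0 < δ →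
      ∫ s in {s : UnitAddCircle | δ ≤ ‖s‖}, ‖∑ m ∈ Sψ (k 1), ψ (k 1) m * fourier (-m) s‖ ≤ τ / δ := by
    intro k hk δ hδ
    refine (setIntegral_norm_trapezoidKernel_le (hfib k hk) (hψk k hk) hδ
      (measurableSet_le measurable_const continuous_norm.measurable) (fun s hs => hs)).trans ?_
    have hx : ((Λ * G : ℕ) : ℝ) ≤ (((k 1).natAbs * G : ℕ) : ℝ) := by
      exact_mod_cast Nat.mul_le_mul_right _ (hnat k hk).1
    rw [hτ, div_div, div_le_div_iff₀ (by nlinarith) (by positivity)]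
    nlinarith [Real.pi_pos, mul_le_mul_of_nonneg_right hx hδ.le]
  have hAd' : 8 * τ ≤ A * d₀ := hAd
  have hε' : ∀ k ∈ W, A * (2 * π * |((k 1 * G : ℤ) : ℝ)| * (Real.exp (-(M ^ 2 / 2)) / (2 * P.N j))) ≤ ε₀ := by
    intro k hk
    refine le_trans (mul_le_mul_of_nonneg_left (mul_le_mul_of_nonneg_right
      (mul_le_mul_of_nonneg_left ?_ (by positivity)) (by positivity)) hA0) hε
    rw [← Int.cast_abs, ← hnG]
    exact_mod_cast Nat.mul_le_mul_right _ (hnat k hk).2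
  -- the abstract half-step
  have hmain := sum_window_sq_norm_vstep_twist_le P hγ hδ₀ hd hN₀ hρN j hb hbs hb1 W χ _ hχS hχ1 Q₂ hχL ψ Sψ hψS hψ0 hψ1
    hd₀ hM hMδ hMd hA0 hA' hτ' hAd' hε0 hε'
  refine hmain.trans (pow_le_pow_left₀ (by positivity) (add_le_add ?_ (Real.sqrt_le_sqrt ?_)) 2)
  · -- kernel `L¹` norm of the input trapezoid
    have hK := integral_norm_trapezoidKernel_le_ratio hQ hχ
    have hS0 : 0 ≤ ε₀ + A * Real.sqrt ((2 * P.N j : ℕ) * (4 * d₀)) := by positivity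
    exact mul_le_mul_of_nonneg_right hK hS0
  · -- the pass-through term as a spectral class
    refine sum_passThrough_le_tsum hb hχS (fun l => ?_) (fun l hl => (trapezoid_values hQ hχ l).1 hl) _
      (fun n hn => ?_)
    · exact ⟨_, (clamp_facts (((Q₂ : ℝ) - |(l : ℝ)|) / ((Q₂ : ℝ) - Q₁)) 0).1,
        (clamp_facts (((Q₂ : ℝ) - |(l : ℝ)|) / ((Q₂ : ℝ) - Q₁)) 0).2.1, hχ l⟩
    · obtain ⟨k, hk, rfl⟩ := Finset.mem_image.mp hn
      exact (hW k hk).2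

end Summit.AnomalousDissipation.AnomalousDissipation.Theorems.SawtoothPulseCascade.K1Window
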